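import Summits.CriticalPhenomena.PercolationContinuityZ3.Theorems.Transplant.SkelPhiFaceSchedBoxes2
import Summits.CriticalPhenomena.PercolationContinuityZ3.Theorems.Transplant.SkelPhiParaRunDisp
import Literature.Probability.LatticeModels.ThermodynamicLimit
import HarnessLib

/-!
# N1 (the `{±1}` node), LEVEL 1 kit layer: SEED CLEARANCE OF RUN REGIONS IN THE SERVED FORM `w ∉ S` — α-form AND level-form

The face route datum (`faceRoute_of_bridge₃`, hp-8 g33) uses its clearance hypotheses `hclear₂/hclear₃ : … → kb < rootFrame φ c σ w 0` only to
derive `Disjoint S (Win ψ c (region k) L)` for the pinned seed `S`; (L-F1)/(L-F5) (lane INBOX 2026-08-21T23:58Z, 2026-08-22T01:15Z, 01:09:22Z) show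
that the α-only (coordinate-`0`) form is not dischargeable for every region of the y′-face route, while the seed of the face step is the small zone
`Λc c′ kz ⊆ Λc c′ Mz` with `φ s − φ c′ ∈ box 2 Mz` (keystone `hkits_faceSteps_of_nums5` :141).  This file serves the clearance of a run region from
such a seed DIRECTLY in the form `∀ w, ψ w ∈ region k → w ∉ S` (the shape hp-8 g34's `faceRoute_of_bridge₄` consumes), in two ways:
* **α-form** (the run's `σ·α` coordinate lies beyond the seed box: the bridge offset) — `not_mem_seed_of_alpha`, served over the schedules of record as
  `yRun_region_clear_alpha` (transverse coordinate of the y′-run) and `xRun_region_clear_alpha` (along coordinate of the x-run);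
* **level-form** (the run's sheared height `σ·β′` lies beyond `U·Mz`, `U = n + |h|`: regions of the y′-run from the fifth on, and every region of a
  tangential x-run started high above the contact) — `not_mem_seed_of_level_runY`, `not_mem_seed_of_level_runX`, served as `yRun_region_clear_level`,
  `xRun_region_clear_level`;
plus the window corollary `disjoint_Win_of_region_clear`.  Pure bookkeeping over `xRunSched/yRunSched` (`SkelPhiFaceSchedBoxes2`: the regions as explicit
boxes) and the floored frames `runX/runY` (`SkelPhiParaRunFrame`); no probability.

WHY NOT A DRIFT RE-VERSION (record, lane INBOX 2026-08-22T01:09:22Z, p1-g13): both served top pieces `pgTopPieceW … σ τ v` contain the split line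
`σα = v`, and siting moves the next seed centre by up to `R′`; so the contact trajectory `σα(t_k) = σα(t_0) + k·(v − R′)` is admissible under every
steering policy, every valid run record's region `k` has transverse floor `≤ σα(t_0) − n + k·(v − R′)`, and `yRunSched` attains it — no re-placement of
cores improves the α-clearance of a y′-run; what remains is the hop side (sign of `v`), the bridge offset, and the LEVEL form below.

builds on p205010 (kernel theorem, internal audit signed; external expert review pending) — nothing in this file uses p205010; nothing here is a
claim about the open node `SamePDropOfSkeletonNeg`.
Lane `prim-bschramm`, seat `prim-bschramm-p1` (gen 13); helper file (`--supports stmt-CriticalPhenomena-4575 --as helper`).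
[cite: KozmaNitzan2024, §4 Lemma 11 (pp. 22–23: the slabs of Ω avoid the explored cluster), Lemma 12 (pp. 23–25)]
[cite: MartineauTassion2017, §4.1, §4.3 Lemma 4.2 (arXiv:1312.1946 pp. 12–14)]
-/

noncomputable section

open scoped Classical

namespace Summit.CriticalPhenomena.PercolationContinuityZ3.Theorems.Transplant

namespace Skelφ

open Literature.Probability.Percolation Literature.Probability.LatticeModels SimpleGraph
open Literature.Barriers.CriticalPhenomena (graphBall)
open ChainPlanar ChainPara

variable {V : Type} {G : SimpleGraph V} {φ : V → Site 2}

/-! ## §1 Floored run coordinates versus the sheared height `σ·β′` -/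

/-- `a ≤ ⌊σβ′/U⌋ ⇒ U·a ≤ σβ′` (y′-frame, along coordinate). [folklore] -/
theorem mul_le_shearCoord_of_le_runY_zero {n : ℕ} (hn : 1 ≤ n) (c₀ : V) (h σ : ℤ) {w : V} {a : ℤ}
    (ha : a ≤ runY φ c₀ n h σ w 0) : (shearUnit n h : ℤ) * a ≤ σ * shearCoord φ c₀ n h w := by
  rw [runY_zero] at ha
  have h1 := (Int.le_ediv_iff_mul_le (shearUnit_pos hn h)).1 ha
  linarith

/-- `⌊σβ′/U⌋ ≤ b ⇒ σβ′ < U·(b + 1)` (y′-frame, along coordinate). [folklore] -/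
theorem shearCoord_lt_mul_of_runY_zero_le {n : ℕ} (hn : 1 ≤ n) (c₀ : V) (h σ : ℤ) {w : V} {b : ℤ}
    (hb : runY φ c₀ n h σ w 0 ≤ b) : σ * shearCoord φ c₀ n h w < (shearUnit n h : ℤ) * (b + 1) := by
  rw [runY_zero] at hb
  have h1 : σ * shearCoord φ c₀ n h w / (shearUnit n h : ℤ) < b + 1 := by linarith
  have h2 := (Int.ediv_lt_iff_lt_mul (shearUnit_pos hn h)).1 h1
  linarith

/-- `a ≤ ⌊σβ′/U⌋ ⇒ U·a ≤ σβ′` (x-frame, transverse coordinate). [folklore] -/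
theorem mul_le_shearCoord_of_le_runX_one {n : ℕ} (hn : 1 ≤ n) (c₀ : V) (h σ : ℤ) {w : V} {a : ℤ}
    (ha : a ≤ runX φ c₀ n h σ w 1) : (shearUnit n h : ℤ) * a ≤ σ * shearCoord φ c₀ n h w :=
  mul_le_shearCoord_of_le_runY_zero hn c₀ h σ (by simpa [runY_zero, runX_one] using ha)

/-- `⌊σβ′/U⌋ ≤ b ⇒ σβ′ < U·(b + 1)` (x-frame, transverse coordinate). [folklore] -/
theorem shearCoord_lt_mul_of_runX_one_le {n : ℕ} (hn : 1 ≤ n) (c₀ : V) (h σ : ℤ) {w : V} {b : ℤ}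
    (hb : runX φ c₀ n h σ w 1 ≤ b) : σ * shearCoord φ c₀ n h w < (shearUnit n h : ℤ) * (b + 1) :=
  shearCoord_lt_mul_of_runY_zero_le hn c₀ h σ (by simpa [runY_zero, runX_one] using hb)

/-- `|⌊σβ′/U⌋| ≤ b ⇒ |β′| < U·(b + 1)` (x-frame, transverse coordinate, `σ = ±1`). [folklore] -/
theorem abs_shearCoord_lt_of_abs_runX_one_le {n : ℕ} (hn : 1 ≤ n) (c₀ : V) (h : ℤ) {σ : ℤ} (hσ : σ = 1 ∨ σ = -1) {w : V} {b : ℤ}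
    (hb : |runX φ c₀ n h σ w 1| ≤ b) : |shearCoord φ c₀ n h w| < (shearUnit n h : ℤ) * (b + 1) := by
  rw [abs_le] at hb
  have h1 := mul_le_shearCoord_of_le_runX_one hn c₀ h σ hb.1
  have h2 := shearCoord_lt_mul_of_runX_one_le hn c₀ h σ hb.2
  have hU := shearUnit_pos hn h
  rw [abs_lt]
  rcases hσ with rfl | rfl
  · constructor <;> nlinarith
  · constructor <;> nlinarith

/-! ## §2 The seed's box read in `α` and in `β′` -/

/-- A vertex of the seed box `φ s − φ c′ ∈ box 2 M` has `|α_{c′}(s)|, |β_{c′}(s)| ≤ M`. [folklore] -/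
theorem abs_relCoord_le_of_box {c' s : V} {M : ℕ} (hs : φ s - φ c' ∈ box 2 M) (i : Fin 2) : |relCoord φ c' i s| ≤ M := by
  rw [mem_box] at hs
  have h1 := hs i
  simp only [Pi.sub_apply] at h1
  rw [relCoord_apply, abs_le]
  exact ⟨h1.1, h1.2⟩

/-- A vertex of the seed box has `|β′_{c′}(s)| ≤ (n + |h|)·M`. [folklore] -/
theorem abs_shearCoord_le_of_box {c' s : V} {M : ℕ} (hs : φ s - φ c' ∈ box 2 M) (n : ℕ) (h : ℤ) :
    |shearCoord φ c' n h s| ≤ (shearUnit n h : ℤ) * M := by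
  have h0 : |φ s 0 - φ c' 0| ≤ (M : ℤ) := by simpa [relCoord_apply] using abs_relCoord_le_of_box hs 0
  have h1 : |φ s 1 - φ c' 1| ≤ (M : ℤ) := by simpa [relCoord_apply] using abs_relCoord_le_of_box hs 1
  have h2 := abs_shearCoord_sub_le_of_φ (φ := φ) c' n h h0 h1
  simpa [shearCoord_apply] using h2

/-! ## §3 Clearance of one vertex: α-form and level-form -/

/-- **α-form**: if the seed lies in the box `M` about `c′`, the run origin `c₀` is within `B` of `c′` in `α`, and `σ·α_{c₀}(w) ≥ a > M + B`, then
`w ∉ S`. [cite: KozmaNitzan2024, §4 Lemma 11 (p. 22)] -/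
theorem not_mem_seed_of_alpha {S : Finset V} {c' : V} {M : ℕ} (hS : ∀ s ∈ S, φ s - φ c' ∈ box 2 M) (c₀ : V) {σ : ℤ} (hσ : σ = 1 ∨ σ = -1)
    {w : V} {a B : ℤ} (hoff : |relCoord φ c' 0 c₀| ≤ B) (ha : a ≤ σ * relCoord φ c₀ 0 w) (hgap : (M : ℤ) + B < a) : w ∉ S := by
  intro hw
  have h1 := abs_relCoord_le_of_box (hS w hw) 0
  rw [relCoord_apply, abs_le] at h1 hoff
  rw [relCoord_apply] at ha
  rcases hσ with rfl | rfl
  · linarith [h1.2, hoff.1]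
  · linarith [h1.1, hoff.2]

/-- **Level-form, y′-frame**: if the seed lies in the box `M` about `c′`, `|β′_{c′}(c₀)| ≤ B`, and the along coordinate `runY w 0 = ⌊σβ′_{c₀}(w)/U⌋ ≥ a`
with `U·a > U·M + B`, then `w ∉ S`. [cite: KozmaNitzan2024, §4 Lemma 11 (p. 22)] -/
theorem not_mem_seed_of_level_runY {S : Finset V} {c' : V} {M : ℕ} (hS : ∀ s ∈ S, φ s - φ c' ∈ box 2 M) {n : ℕ} (hn : 1 ≤ n) (c₀ : V) (h : ℤ)
    {σ : ℤ} (hσ : σ = 1 ∨ σ = -1) {w : V} {a B : ℤ} (hoff : |shearCoord φ c' n h c₀| ≤ B) (ha : a ≤ runY φ c₀ n h σ w 0)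
    (hgap : (shearUnit n h : ℤ) * M + B < (shearUnit n h : ℤ) * a) : w ∉ S := by
  intro hw
  have h1 := abs_shearCoord_le_of_box (hS w hw) n h
  have h2 := mul_le_shearCoord_of_le_runY_zero hn c₀ h σ ha
  have e : shearCoord φ c₀ n h w = shearCoord φ c' n h w - shearCoord φ c' n h c₀ := shearCoord_sub_origin φ c' c₀ n h w
  rw [abs_le] at h1 hoff
  rw [e] at h2
  rcases hσ with rfl | rfl
  · linarith [h1.2, hoff.1]
  · linarith [h1.1, hoff.2]

/-- **Level-form, x-frame** (a tangential run from a HIGH origin): if the seed lies in the box `M` about `c′`, the origin satisfies `|β′_{c′}(c₀)| ≥ H`,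
and the transverse coordinate `|runX w 1| ≤ b` with `U·M + U·(b+1) ≤ H`, then `w ∉ S`. [cite: KozmaNitzan2024, §4 Lemma 12 (pp. 23–25)] -/
theorem not_mem_seed_of_level_runX {S : Finset V} {c' : V} {M : ℕ} (hS : ∀ s ∈ S, φ s - φ c' ∈ box 2 M) {n : ℕ} (hn : 1 ≤ n) (c₀ : V) (h : ℤ)
    {σ : ℤ} (hσ : σ = 1 ∨ σ = -1) {w : V} {b H : ℤ} (horig : H ≤ |shearCoord φ c' n h c₀|) (hb : |runX φ c₀ n h σ w 1| ≤ b)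
    (hgap : (shearUnit n h : ℤ) * M + (shearUnit n h : ℤ) * (b + 1) ≤ H) : w ∉ S := by
  intro hw
  have h1 := abs_shearCoord_le_of_box (hS w hw) n h
  have h2 := abs_shearCoord_lt_of_abs_runX_one_le hn c₀ h hσ hb
  have e : shearCoord φ c₀ n h w = shearCoord φ c' n h w - shearCoord φ c' n h c₀ := shearCoord_sub_origin φ c' c₀ n h w
  rw [e] at h2
  rw [abs_le] at h1
  rw [abs_lt] at h2
  rcases le_abs.1 horig with h3 | h3
  · linarith [h1.2, h2.1]
  · linarith [h1.1, h2.2]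

/-! ## §4 Served forms over the schedules of record (`∀ w, ψ w ∈ region k → w ∉ S`) -/

/-- **y′-run, α-form**: region `k` of `yRunSched` read in `runY φ c₀ n h σ` is seed-clear as soon as its transverse floor
`k·v − (n+v)⁺ − (k+1)·R′ − n` exceeds `M + B` (`B ≥ |α_{c′}(c₀)|`). [cite: KozmaNitzan2024, §4 Lemma 11 (p. 22)] -/
theorem yRun_region_clear_alpha {S : Finset V} {c' : V} {M : ℕ} (hS : ∀ s ∈ S, φ s - φ c' ∈ box 2 M) {n ℓ : ℕ} {h v : ℤ} (hn : 1 ≤ n)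
    (hv : |v| ≤ n) (hlay : (n + h.natAbs : ℕ) ≤ (n : ℤ) * ℓ + 1) (c₀ : V) {σ : ℤ} (hσ : σ = 1 ∨ σ = -1) (R' q N : ℕ) {B : ℤ}
    (hoff : |relCoord φ c' 0 c₀| ≤ B) {k : ℕ}
    (hgap : (M : ℤ) + B < (k : ℤ) * v - ((((((n : ℤ) + v).toNat : ℕ) : ℤ)) + (k : ℤ) * R') - R' - n)
    {w : V} (hw : runY φ c₀ n h σ w ∈ (yRunSched hn hv hlay R' q N).region k) : w ∉ S := by
  have hb := yRunSched_region_subset hn hv hlay R' q N k hw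
  rw [mem_Icc_pt_iff] at hb
  have h1 : (k : ℤ) * v - ((((((n : ℤ) + v).toNat : ℕ) : ℤ)) + (k : ℤ) * R') - R' - n ≤ σ * relCoord φ c₀ 0 w := by
    simpa [runY_one] using hb.2.1
  exact not_mem_seed_of_alpha hS c₀ hσ hoff h1 hgap

/-- **y′-run, level-form**: region `k` of `yRunSched` read in `runY φ c₀ n h σ` is seed-clear as soon as its along floor
`k·sLo − q − (k+1)·R′ − La` (`sLo = (nℓ − U + 1)/U`, `La = 3nℓ/U + 1`) times `U` exceeds `U·M + B` (`B ≥ |β′_{c′}(c₀)|`).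
[cite: KozmaNitzan2024, §4 Lemma 11 (p. 22)] -/
theorem yRun_region_clear_level {S : Finset V} {c' : V} {M : ℕ} (hS : ∀ s ∈ S, φ s - φ c' ∈ box 2 M) {n ℓ : ℕ} {h v : ℤ} (hn : 1 ≤ n)
    (hv : |v| ≤ n) (hlay : (n + h.natAbs : ℕ) ≤ (n : ℤ) * ℓ + 1) (c₀ : V) {σ : ℤ} (hσ : σ = 1 ∨ σ = -1) (R' q N : ℕ) {B : ℤ}
    (hoff : |shearCoord φ c' n h c₀| ≤ B) {k : ℕ}
    (hgap : (shearUnit n h : ℤ) * M + B < (shearUnit n h : ℤ) *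
      ((k : ℤ) * (((n : ℤ) * ℓ - (shearUnit n h : ℕ) + 1) / (shearUnit n h : ℕ)) - q - (k : ℤ) * R' - R' -
        ((3 * (n * ℓ) / shearUnit n h + 1 : ℕ) : ℤ)))
    {w : V} (hw : runY φ c₀ n h σ w ∈ (yRunSched hn hv hlay R' q N).region k) : w ∉ S := by
  have hb := yRunSched_region_subset hn hv hlay R' q N k hw
  rw [mem_Icc_pt_iff] at hb
  exact not_mem_seed_of_level_runY hS hn c₀ h hσ hoff hb.1.1 hgap

/-- **x-run, α-form**: region `k` of `xRunSched` read in `runX φ c₀ n h σ` is seed-clear as soon as its along floor `k·n − q − (k+1)·R′ − n` exceeds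
`M + B` (`B ≥ |α_{c′}(c₀)|`). [cite: KozmaNitzan2024, §4 Lemma 11 (p. 22)] -/
theorem xRun_region_clear_alpha {S : Finset V} {c' : V} {M : ℕ} (hS : ∀ s ∈ S, φ s - φ c' ∈ box 2 M) (n : ℕ) (c₀ : V) (h : ℤ)
    {σ : ℤ} (hσ : σ = 1 ∨ σ = -1) (ℓ R' q N : ℕ) {B : ℤ} (hoff : |relCoord φ c' 0 c₀| ≤ B) {k : ℕ}
    (hgap : (M : ℤ) + B < (k : ℤ) * n - q - (k : ℤ) * R' - R' - n)
    {w : V} (hw : runX φ c₀ n h σ w ∈ (xRunSched n ℓ h R' q N).region k) : w ∉ S := by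
  have hb := xRunSched_region_subset n ℓ h R' q N k hw
  rw [mem_Icc_pt_iff] at hb
  have h1 : (k : ℤ) * n - q - (k : ℤ) * R' - R' - n ≤ σ * relCoord φ c₀ 0 w := by simpa [runX_zero] using hb.1.1
  exact not_mem_seed_of_alpha hS c₀ hσ hoff h1 hgap

/-- **x-run, level-form** (tangential run from a high origin): region `k` of `xRunSched` read in `runX φ c₀ n h σ` is seed-clear as soon as
`U·M + U·(W + (k+1)·R′ + Lb + 1) ≤ H ≤ |β′_{c′}(c₀)|` (`W = nℓ/U + 1`, `Lb = 3nℓ/U + 1`). [cite: KozmaNitzan2024, §4 Lemma 12 (pp. 23–25)] -/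
theorem xRun_region_clear_level {S : Finset V} {c' : V} {M : ℕ} (hS : ∀ s ∈ S, φ s - φ c' ∈ box 2 M) {n : ℕ} (hn : 1 ≤ n) (c₀ : V) (h : ℤ)
    {σ : ℤ} (hσ : σ = 1 ∨ σ = -1) (ℓ R' q N : ℕ) {H : ℤ} (horig : H ≤ |shearCoord φ c' n h c₀|) {k : ℕ}
    (hgap : (shearUnit n h : ℤ) * M + (shearUnit n h : ℤ) *
      ((((n * ℓ / shearUnit n h + 1 : ℕ) : ℤ) + (k : ℤ) * R' + R' + ((3 * (n * ℓ) / shearUnit n h + 1 : ℕ) : ℤ)) + 1) ≤ H)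
    {w : V} (hw : runX φ c₀ n h σ w ∈ (xRunSched n ℓ h R' q N).region k) : w ∉ S := by
  have hb := xRunSched_region_subset n ℓ h R' q N k hw
  rw [mem_Icc_pt_iff] at hb
  have h1 : |runX φ c₀ n h σ w 1| ≤
      (((n * ℓ / shearUnit n h + 1 : ℕ) : ℤ) + (k : ℤ) * R' + R' + ((3 * (n * ℓ) / shearUnit n h + 1 : ℕ) : ℤ)) := by
    rw [abs_le]
    constructor <;> linarith [hb.2.1, hb.2.2]
  exact not_mem_seed_of_level_runX hS hn c₀ h hσ horig h1 hgap

/-! ## §5 The window corollary -/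

/-- A region that is seed-clear vertexwise has a seed-free window (the `Disjoint S (stepDF k)` input of the chain facts).
[cite: KozmaNitzan2024, §4 Lemma 10 Step IV (pp. 20–21)] -/
theorem disjoint_Win_of_region_clear [G.LocallyFinite] {ψ : V → Site 2} {P : Finset (Site 2)} {S : Finset V} (c : V) (L : ℕ)
    (h : ∀ w, ψ w ∈ P → w ∉ S) : Disjoint S (Win G ψ c P L) := by
  refine Finset.disjoint_left.2 fun w hwS hw => ?_
  rw [mem_Win] at hw
  exact h w hw.2 hwS

/-- The same with the clearance asked only inside the kit ball (the literal shape of `faceRoute_of_bridge₃`'s `hclear`). [folklore] -/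
theorem disjoint_Win_of_region_clear' [G.LocallyFinite] {ψ : V → Site 2} {P : Finset (Site 2)} {S : Finset V} (c : V) (L : ℕ)
    (h : ∀ w ∈ graphBall G c L, ψ w ∈ P → w ∉ S) : Disjoint S (Win G ψ c P L) := by
  refine Finset.disjoint_left.2 fun w hwS hw => ?_
  rw [mem_Win] at hw
  exact h w hw.1 hw.2 hwS

/-! ## §6 Signed-offset forms (the bridge geometry: the run origin sits far from the contact on a definite side) -/

/-- **α-form, signed offset**: seed in the box `M` about `c′`; reading sign `s = ±1`; the run origin has `s·α_{c′}(c₀) ≥ D₀` and the vertex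
`s·α_{c₀}(w) ≥ a` with `D₀ + a > M` ⇒ `w ∉ S` (the region may lie "below" its own origin, `a < 0`, as long as the origin's offset pays for it).
[cite: KozmaNitzan2024, §4 Lemma 11 (p. 22)] -/
theorem not_mem_seed_of_alpha_off {S : Finset V} {c' : V} {M : ℕ} (hS : ∀ s ∈ S, φ s - φ c' ∈ box 2 M) (c₀ : V) {s : ℤ} (hs : s = 1 ∨ s = -1)
    {w : V} {a D₀ : ℤ} (hoff : D₀ ≤ s * relCoord φ c' 0 c₀) (ha : a ≤ s * relCoord φ c₀ 0 w) (hgap : (M : ℤ) < D₀ + a) : w ∉ S := by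
  intro hw
  have h1 := abs_relCoord_le_of_box (hS w hw) 0
  rw [relCoord_apply, abs_le] at h1
  rw [relCoord_apply] at ha hoff
  rcases hs with rfl | rfl
  · linarith [h1.2]
  · linarith [h1.1]

/-- **Level-form, y′-frame, signed offset**: seed in the box `M` about `c′`; the run origin has `σ·β′_{c′}(c₀) ≥ D`; the along coordinate
`runY w 0 ≥ a` with `D + U·a > U·M` ⇒ `w ∉ S`. [cite: KozmaNitzan2024, §4 Lemma 11 (p. 22)] -/
theorem not_mem_seed_of_level_runY_off {S : Finset V} {c' : V} {M : ℕ} (hS : ∀ s ∈ S, φ s - φ c' ∈ box 2 M) {n : ℕ} (hn : 1 ≤ n) (c₀ : V)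
    (h : ℤ) {σ : ℤ} (hσ : σ = 1 ∨ σ = -1) {w : V} {a D : ℤ} (hoff : D ≤ σ * shearCoord φ c' n h c₀) (ha : a ≤ runY φ c₀ n h σ w 0)
    (hgap : (shearUnit n h : ℤ) * M < D + (shearUnit n h : ℤ) * a) : w ∉ S := by
  intro hw
  have h1 := abs_shearCoord_le_of_box (hS w hw) n h
  have h2 := mul_le_shearCoord_of_le_runY_zero hn c₀ h σ ha
  have e : shearCoord φ c₀ n h w = shearCoord φ c' n h w - shearCoord φ c' n h c₀ := shearCoord_sub_origin φ c' c₀ n h w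
  rw [abs_le] at h1
  rw [e] at h2
  rcases hσ with rfl | rfl
  · linarith [h1.2]
  · linarith [h1.1]

/-- **y′-run, α-form, FLOOR side** (`s = σ`: the origin sits at `σ·α_{c′}(c₀) ≥ D₀` and region `k`'s transverse floor
`k·v − (n+v)⁺ − (k+1)·R′ − n` is paid for by `D₀`). [cite: KozmaNitzan2024, §4 Lemma 11 (p. 22)] -/
theorem yRun_region_clear_alpha_lo {S : Finset V} {c' : V} {M : ℕ} (hS : ∀ s ∈ S, φ s - φ c' ∈ box 2 M) {n ℓ : ℕ} {h v : ℤ} (hn : 1 ≤ n)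
    (hv : |v| ≤ n) (hlay : (n + h.natAbs : ℕ) ≤ (n : ℤ) * ℓ + 1) (c₀ : V) {σ : ℤ} (hσ : σ = 1 ∨ σ = -1) (R' q N : ℕ) {D₀ : ℤ}
    (hoff : D₀ ≤ σ * relCoord φ c' 0 c₀) {k : ℕ}
    (hgap : (M : ℤ) < D₀ + ((k : ℤ) * v - ((((((n : ℤ) + v).toNat : ℕ) : ℤ)) + (k : ℤ) * R') - R' - n))
    {w : V} (hw : runY φ c₀ n h σ w ∈ (yRunSched hn hv hlay R' q N).region k) : w ∉ S := by
  have hb := yRunSched_region_subset hn hv hlay R' q N k hw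
  rw [mem_Icc_pt_iff] at hb
  have h1 : (k : ℤ) * v - ((((((n : ℤ) + v).toNat : ℕ) : ℤ)) + (k : ℤ) * R') - R' - n ≤ σ * relCoord φ c₀ 0 w := by
    simpa [runY_one] using hb.2.1
  exact not_mem_seed_of_alpha_off hS c₀ hσ hoff h1 hgap

/-- **y′-run, α-form, CEILING side** (`s = −σ`: the origin sits at `−σ·α_{c′}(c₀) ≥ D₀` and region `k`'s transverse ceiling
`k·v + (n−v)⁺ + (k+1)·R′ + n` is paid for by `D₀`). [cite: KozmaNitzan2024, §4 Lemma 11 (p. 22)] -/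
theorem yRun_region_clear_alpha_hi {S : Finset V} {c' : V} {M : ℕ} (hS : ∀ s ∈ S, φ s - φ c' ∈ box 2 M) {n ℓ : ℕ} {h v : ℤ} (hn : 1 ≤ n)
    (hv : |v| ≤ n) (hlay : (n + h.natAbs : ℕ) ≤ (n : ℤ) * ℓ + 1) (c₀ : V) {σ : ℤ} (hσ : σ = 1 ∨ σ = -1) (R' q N : ℕ) {D₀ : ℤ}
    (hoff : D₀ ≤ -(σ * relCoord φ c' 0 c₀)) {k : ℕ}
    (hgap : (M : ℤ) < D₀ - ((k : ℤ) * v + ((((((n : ℤ) - v).toNat : ℕ) : ℤ)) + (k : ℤ) * R') + R' + n))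
    {w : V} (hw : runY φ c₀ n h σ w ∈ (yRunSched hn hv hlay R' q N).region k) : w ∉ S := by
  have hb := yRunSched_region_subset hn hv hlay R' q N k hw
  rw [mem_Icc_pt_iff] at hb
  have hs : -σ = 1 ∨ -σ = -1 := by rcases hσ with rfl | rfl <;> simp
  have h1 : -((k : ℤ) * v + ((((((n : ℤ) - v).toNat : ℕ) : ℤ)) + (k : ℤ) * R') + R' + n) ≤ -σ * relCoord φ c₀ 0 w := by
    have h2 : σ * relCoord φ c₀ 0 w ≤ (k : ℤ) * v + ((((((n : ℤ) - v).toNat : ℕ) : ℤ)) + (k : ℤ) * R') + R' + n := by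
      simpa [runY_one] using hb.2.2
    linarith
  exact not_mem_seed_of_alpha_off hS c₀ hs (by simpa [neg_mul] using hoff) h1 (by linarith)

/-- **x-run, α-form, FLOOR side** (the run advances along `+σα` from an origin at `σ·α_{c′}(c₀) ≥ D₀`; region `k`'s along floor
`k·n − q − (k+1)·R′ − n` is paid for by `D₀`). [cite: KozmaNitzan2024, §4 Lemma 11 (p. 22)] -/
theorem xRun_region_clear_alpha_lo {S : Finset V} {c' : V} {M : ℕ} (hS : ∀ s ∈ S, φ s - φ c' ∈ box 2 M) (n : ℕ) (c₀ : V) (h : ℤ)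
    {σ : ℤ} (hσ : σ = 1 ∨ σ = -1) (ℓ R' q N : ℕ) {D₀ : ℤ} (hoff : D₀ ≤ σ * relCoord φ c' 0 c₀) {k : ℕ}
    (hgap : (M : ℤ) < D₀ + ((k : ℤ) * n - q - (k : ℤ) * R' - R' - n))
    {w : V} (hw : runX φ c₀ n h σ w ∈ (xRunSched n ℓ h R' q N).region k) : w ∉ S := by
  have hb := xRunSched_region_subset n ℓ h R' q N k hw
  rw [mem_Icc_pt_iff] at hb
  have h1 : (k : ℤ) * n - q - (k : ℤ) * R' - R' - n ≤ σ * relCoord φ c₀ 0 w := by simpa [runX_zero] using hb.1.1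
  exact not_mem_seed_of_alpha_off hS c₀ hσ hoff h1 hgap

/-- **y′-run, level-form, signed offset** (origin at `σ·β′_{c′}(c₀) ≥ D`, region `k`'s along floor `k·sLo − q − (k+1)·R′ − La`).
[cite: KozmaNitzan2024, §4 Lemma 11 (p. 22)] -/
theorem yRun_region_clear_level_off {S : Finset V} {c' : V} {M : ℕ} (hS : ∀ s ∈ S, φ s - φ c' ∈ box 2 M) {n ℓ : ℕ} {h v : ℤ} (hn : 1 ≤ n)
    (hv : |v| ≤ n) (hlay : (n + h.natAbs : ℕ) ≤ (n : ℤ) * ℓ + 1) (c₀ : V) {σ : ℤ} (hσ : σ = 1 ∨ σ = -1) (R' q N : ℕ) {D : ℤ}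
    (hoff : D ≤ σ * shearCoord φ c' n h c₀) {k : ℕ}
    (hgap : (shearUnit n h : ℤ) * M < D + (shearUnit n h : ℤ) *
      ((k : ℤ) * (((n : ℤ) * ℓ - (shearUnit n h : ℕ) + 1) / (shearUnit n h : ℕ)) - q - (k : ℤ) * R' - R' -
        ((3 * (n * ℓ) / shearUnit n h + 1 : ℕ) : ℤ)))
    {w : V} (hw : runY φ c₀ n h σ w ∈ (yRunSched hn hv hlay R' q N).region k) : w ∉ S := by
  have hb := yRunSched_region_subset hn hv hlay R' q N k hw
  rw [mem_Icc_pt_iff] at hb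
  exact not_mem_seed_of_level_runY_off hS hn c₀ h hσ hoff hb.1.1 hgap

end Skelφ

end Summit.CriticalPhenomena.PercolationContinuityZ3.Theorems.Transplant

end
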